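import Mathlib.CategoryTheory.Comma.Over.Basic
import Literature.AlgebraicGeometry.Frobenioids.PreFrobenioidMorphisms
import Literature.AlgebraicGeometry.Frobenioids.CategoriesFactorization
import Literature.AlgebraicGeometry.Frobenioids.FiniteEtaleBase
import HarnessLib

/-!
# Frobenioids II, Proposition 3.5 (Iso-subanchors) and Remark 3.5.1

Mochizuki, *The geometry of Frobenioids II: poly-Frobenioids*, Kyushu J. Math. **62** (2008)
401–460, §3 "Archimedean Primes", Proposition 3.5 (i)–(iv) and Remark 3.5.1, author's (kurims) text
pp. 34–36 [cite: MochizukiFrdII2008, Prop 3.5 pp.34-36].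

> **Proposition 3.5. (Iso-subanchors)** In the notation and terminology of Example 3.3, let `F` be one
> of the categories `C`, `A`; `G` one of the categories `N`, `R`; `H` one of the categories `F`, `G`.
> […] Suppose further that `D` is of RC-iso-subanchor type. Then: (i) Let `A ∈ Ob(H)`; suppose that
> `B_D → A_D := Base(A)` is a mono-minimal categorical quotient of `B_D` by a group `G_D ⊆ Aut_D(B_D)`
> in `D`. Then there exists a pull-back morphism `B → A` that lifts `B_D → A_D` and a group
> `G ⊆ Aut_H(B)` that maps isomorphically to `G_D` such that `B → A` is a mono-minimal categorical
> quotient of `B` by `G` in `H`. (ii) The Frobenioid `F` is quasi-isotropic, i.e., an object of `F` is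
> non-isotropic if and only if it is an iso-subanchor of `F`. (iii) `G` is of RC-iso-subanchor type.
> (iv) `F` is not of RC-iso-subanchor type.

**How the statements are typed (statements-first; nothing here is asserted).** Example 3.3 constructs,
from a connected totally epimorphic category `D` with a functor `D → D₀` to the base category `D₀` of
§3 (connected finite étale coverings of `Spec ℝ`, `ArchBase` of `FiniteEtaleBase.lean`), the
archimedean Frobenioid `C`, the angular Frobenioid `A ⊆ C` (isometries), and the angloids `N ⊆ A`,
`R`; for `N`, `R` "Frobenioid-theoretic terminology … is to be interpreted as referring to the images
of the objects and morphisms in question in `C` via the natural functors `N → C`, `R → C`" (Ex. 3.3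
(iv), p. 29). Those four categories are the subject of a sibling file (seat abc-iut-L1-t6, ONE WRITER
of the Example 3.3 objects). Accordingly each item below is a `Prop`-valued PREDICATE on the shape the
item speaks about —

* the functor `G : D ⥤ ArchBase` (the base `D → D₀`),
* a pre-Frobenioid structure `F : X ⥤ F_Φ` in the sense of [FrdI] Def. 1.1 (iv) (the Frobenioid `F`,
  or `C` when the item speaks about `N`, `R`), whose typology (`IsPullbackMorphism`, `IsIsotropic`,
  …) is that of `PreFrobenioidMorphisms.lean` ([FrdI] Def. 1.2),
* a functor `ι : H ⥤ X` (the natural functor `H → C`; the identity when `H = F`),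

and the printed CLAIM is the value of the predicate at the Example 3.3 data; the instantiation at the
concrete categories is recorded in the sibling file `ArchimedeanTheoremsInstances.lean` once their
names are fixed. The standing hypothesis "`D` is of RC-iso-subanchor type" ([FrdII] Def. 3.1 (v),
`RC.IsOfRCIsoSubanchorType` of `FiniteEtaleBase.lean`) is the antecedent of every item.
"Quasi-isotropic" in (ii) is [FrdI] Def. 3.1 (i); the text spells it out ("i.e., …") and we type the
spelled-out form (it is, by `Iff.rfl` field-wise, `PreFrobenioidData.IsOfQuasiIsotropicType` of the
§3 files of [FrdI]); "iso-subanchor", "anchor", "mono-minimal categorical quotient" are [FrdI] §0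
(`CategoriesFactorization.lean`). "Lifts `B_D → A_D`" is rendered, as in [FrdI] Def. 1.3 (i)(c)
(`Frobenioid.lean`), up to an isomorphism `Base(B) ≅ B_D` over `A_D`; "maps isomorphically to `G_D`"
is a group isomorphism `G ≃* G_D` intertwining that isomorphism.

Remark 3.5.1 is prose (why subanchors and RC-variants are needed); its one mathematical assertion —
base categories of connected temperoids may have objects that are subanchors but not anchors — is
recorded as the named statement `Rmk351` in the weak form "such totally epimorphic categories exist",
with the printed example in the docstring (temperoids: [FrdII] Ex. 1.3, seat abc-iut-L1-t4).
No statement of the paper is strengthened; typed ≠ proved.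
-/

namespace Literature.AlgebraicGeometry.Frobenioids

open CategoryTheory

universe w v v' v'' u u' u''

namespace ArchFrd

variable {D : Type u} [Category.{v} D] (G : D ⥤ ArchBase)
  {Φ : Dᵒᵖ ⥤ CommMonCat.{w}} {X : Type u'} [Category.{v'} X] (F : X ⥤ ElemFrobenioid Φ)
  {H : Type u''} [Category.{v''} H] (ι : H ⥤ X)

/-! ### Proposition 3.5 (i): lifting mono-minimal categorical quotients -/

/-- **Proposition 3.5 (i)** (FrdII p. 34), for `H` one of `C, A, N, R` with its natural functor
`ι : H → C` (resp. `H → A`) to the Frobenioid `F : X → F_Φ` and base `G : D → D₀` of RC-iso-subanchor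
type: "Let `A ∈ Ob(H)`; suppose that `B_D → A_D := Base(A)` is a mono-minimal categorical quotient of
`B_D` by a group `G_D ⊆ Aut_D(B_D)` in `D`. Then there exists a pull-back morphism `B → A` that lifts
`B_D → A_D` and a group `G ⊆ Aut_H(B)` that maps isomorphically to `G_D` such that `B → A` is a
mono-minimal categorical quotient of `B` by `G` in `H`." The lift is up to an isomorphism
`e : Base(B) ≅ B_D` with `Base(B → A) = e ∘ (B_D → A_D)`, and `G ≃* G_D` intertwines `e`.
[cite: MochizukiFrdII2008, Prop 3.5 (i) p.34] -/
def Prop35i : Prop :=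
  RC.IsOfRCIsoSubanchorType G →
    ∀ (A : H) (BD : D) (fD : BD ⟶ PreFrobenioid.baseObj F (ι.obj A)) (GD : Subgroup (Aut BD)),
      IsMonoMinimalQuotient GD fD →
        ∃ (B : H) (f : B ⟶ A) (e : PreFrobenioid.baseObj F (ι.obj B) ≅ BD) (Γ : Subgroup (Aut B))
          (φ : Γ ≃* GD),
          PreFrobenioid.IsPullbackMorphism F (ι.map f) ∧
            PreFrobenioid.Base F (ι.map f) = e.hom ≫ fD ∧
            (∀ γ : Γ, PreFrobenioid.Base F (ι.map (γ : Aut B).hom) ≫ e.hom =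
              e.hom ≫ ((φ γ : GD) : Aut BD).hom) ∧
            IsMonoMinimalQuotient Γ f

/-! ### Proposition 3.5 (ii): `F` is quasi-isotropic -/

/-- **Proposition 3.5 (ii)** (FrdII p. 34), for `F` one of the Frobenioids `C`, `A` of Example 3.3 over
a base `G : D → D₀` of RC-iso-subanchor type: "The Frobenioid `F` is quasi-isotropic, i.e., an object
of `F` is non-isotropic if and only if it is an iso-subanchor of `F`" (quasi-isotropic = [FrdI]
Def. 3.1 (i); iso-subanchor = [FrdI] §0). [cite: MochizukiFrdII2008, Prop 3.5 (ii) p.34] -/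
def Prop35ii : Prop :=
  RC.IsOfRCIsoSubanchorType G → ∀ A : X, (¬ PreFrobenioid.IsIsotropic F A) ↔ IsIsoSubanchor A

/-! ### Proposition 3.5 (iii), (iv): RC-iso-subanchor type -/

/-- **Proposition 3.5 (iii)** (FrdII p. 34), for `G_cat` one of the angloids `N`, `R` of Example 3.3 with
its natural functor `ι : G_cat → C` and base `G : D → D₀` of RC-iso-subanchor type: "`G_cat` is of
RC-iso-subanchor type" (with respect to its functor `G_cat → C → D → D₀`; [FrdII] Def. 3.1 (v)).
[cite: MochizukiFrdII2008, Prop 3.5 (iii) p.34] -/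
def Prop35iii : Prop :=
  RC.IsOfRCIsoSubanchorType G →
    RC.IsOfRCIsoSubanchorType (ι ⋙ PreFrobenioid.baseFunctor F ⋙ G)

/-- **Proposition 3.5 (iv)** (FrdII p. 34), for `F` one of the Frobenioids `C`, `A` of Example 3.3 over a
base `G : D → D₀` of RC-iso-subanchor type: "`F` is not of RC-iso-subanchor type" (with respect to
`F → D → D₀`). [cite: MochizukiFrdII2008, Prop 3.5 (iv) p.34] -/
def Prop35iv : Prop :=
  RC.IsOfRCIsoSubanchorType G → ¬ RC.IsOfRCIsoSubanchorType (PreFrobenioid.baseFunctor F ⋙ G)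

/-! ### Remark 3.5.1 -/

/-- **Remark 3.5.1** (FrdII p. 36), the mathematical assertion it contains: "it is not difficult to
construct examples of base categories that appear naturally in arithmetic geometry and which have
objects that are subanchors, but not anchors. [Indeed, this phenomenon occurs in the case of the
temperoid associated to a tempered group [such as a nonabelian discrete finitely generated free group]
which admits a topological subquotient isomorphic to an infinite direct sum `⨁ ℤ/pℤ` of copies of
`ℤ/pℤ`, equipped with the discrete topology.]" Typed in the weak form: there is a totally epimorphic
category with an object that is a subanchor but not an anchor ([FrdI] §0). The rest of the Remark
(why Proposition 3.5 works with RC-(iso-)subanchors: its arguments need non-isotropic, hence complex,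
objects mapping to anchors of the base, "thus, one is obliged to work with RC-iso-subanchors in order
to accommodate real objects") is explanatory prose. [cite: MochizukiFrdII2008, Rmk 3.5.1 p.36] -/
def Rmk351 : Prop :=
  ∃ (T : Type u) (_ : Category.{v} T), IsTotallyEpimorphic T ∧ ∃ A : T, IsSubanchor A ∧ ¬ IsAnchor A

end ArchFrd

end Literature.AlgebraicGeometry.Frobenioids
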